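import Summits.QuantumFields.YangMills.Theorems.BalabanUVNodesN15KingModelCurvedKnitObjects

/-!
# BalabanUVNodes ∕ N15 — THE KING-MODEL RUNG, PART Ω-c: THE KING INHABITANT OF dag-n15-w3's CURVED KNIT — `CurvedSpecies.hasMaj_idef_curvDressed_kingTorus`
# (p595387) WITH ITS INDUCTIVE DATUM DISCHARGED BY KING's FULL `A = 0` PROPAGATOR (`tensorId ι A₀⁻¹` on two grids), at the FLAT base point `W′ ≡ 0`, dressed by a
# CONSTANT skew transporter generator `Z′ ≡ Zc` (positive control ∕ non-vacuity of the knit's hypothesis list; King's model, not Bałaban's `G(U)`)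

HONEST FRAMING.  Count-neutral helper (cell `pub-ymgap`, seat `pub-ymgap-dag-n15-e` g14; `--supports stmt-QuantumFields-20544 --as helper` = K3⁷
`SpineGivenEndpointR13SepCoPH`; FAN-OUT v1.1 §N15 s3 «KING-MODEL ∕ RIEMANN-KERNEL RUNG»; dag-n15-w3's ask (α), bus 2026-08-28).  TEMPLATE LITERATURE, `A = 0`:
C. King's scalar U(1)-Higgs MODEL on finite tori ([King1986] (2.13) p. 653, (4.1)–(4.5) p. 670).  dag-n15-w3's END statement of the curved line,
`CurvedSpecies.hasMaj_idef_curvDressed_kingTorus` (`…N15CurvedDressedPairDefectKingTorus`), bounds the η-defect of Bałaban's DRESSED PAIRS `X̂(e^{η′Z′}U′)` vs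
`X̂(e^{ηZ}U)` ((3.63)–(3.65) mechanism) on King's torus pairing `blockOf L M : Tor (fine L M) → Tor M`, displaying as HYPOTHESES: the [B6] carrier, the
INDUCTIVE DATUM — block majorants `βe^{−δd}` of `G(U)`, `D⁺_{R}G(U)`, `D⁻_{R}G(U)` on both grids and their three η-defects `≤ m e^{−δd}` — generator letters,
regimes and a Neumann smallness.  THIS FILE INHABITS that hypothesis list with a GENUINE multi-level propagator: the coarse torus is the rung's η-run
`Tor (fine (L^K) M₀)` (cube `M₀ ≡ 2L^e`, `K ≥ 1` levels), the fine torus dag-n15-w3's `Tor (fine L (fine (L^K) M₀))` = the rung's `(K+1)`-run through part Ω-a's cast,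
`η′ = L^{−(K+1)}`, `blk = blockOf (L^K) M₀` into dag-n15-a's sized unit-torus carrier `unitTorusGeoS` (triangle ∕ row-sum facts `triangle254_unitTorusGeo`,
`rowSum_unitTorusGeo`), `G = tensorId ι A₀⁻¹`, `G′ = tensorId ι (cast-conjugate of A₀′⁻¹)` (dag-n15-c's componentwise lift), `W′ ≡ 0` (FLAT base point: `R ≡ 1`,
file 4's `curvDressed_one` dictionary), `Z′_μ ≡ Zc μ` CONSTANT (every fine-field gradient ∕ second-difference letter holds with `g = G₂ = r_B = g_B = 0`).  The six
inductive-datum families are part Ω-b's nine scalar letters at ONE `(β, δ, m)` (`kingFullProp_uniform_layer_backward`: Ψ-e, P″, Q4a, Σ-d, Ω-a), read on the product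
carrier `X × ι` (`hasMaj_tensorId` ∕ `idef_tensorId`) and through the cast (part Ω-a `hasMaj_conjEquiv` ∕ `hasMaj_pullEquiv_comp`, part Ω-b `idef_conj_eq`,
`covPieces_flat_*`); carrier facts by `triangle254_unitTorusGeo` ∕ `rowSum_unitTorusGeo` (`σ = ρ = δ∕2`).  LEFT DISPLAYED, exactly: the generator datum
`(𝔄, ι, e, Zc)` with `‖Zc μ‖ ≤ r ≤ 1` and skew coordinates, and dag-n15-w3's Neumann smallness `hq` (a smallness condition on `r`).
* ★★ `hasMaj_idef_curvDressed_kingTorus_king` — dag-n15-w3's conclusion VERBATIM at these objects (defect majorant constant `m·((L^K)^{−γ∕2} + (L^K)^{−α})`);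
  `expFitLetter_flat` (the fit letter at the flat point is `2κe·r²η·(…)`), ★ `hasMaj_idef_curvDressed_kingTorus_king_rate` (the η-RATE, explicit: under `β·R_V·c_r ≤ ½` the
  majorant is `≤ 2c_r(mθ_K(1 + 2βR_V) + 2β²F)e^{−(δ∕2)d}`, `θ_K = (L^K)^{−γ∕2} + (L^K)^{−α}`, `F = O(r²·L^{−K})` explicit).
0 `sorry`, standard axioms; no `def`.  HONEST SCOPE: `A = 0`, periodic b.c., odd `L ≥ 3`, cubes `2L^e`, `K ≥ 1`, one
blocking step (`n = 1`), `0 < m² ≤ m₀²`, `0 < γ < 1`, `0 < α < 1`; abelian∕constant transporter at a FLAT base point — NOT a curved base point, NOT Bałaban's `G(U)`,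
NOT the (C3) n-fold transport; a positive control, not an estimate of the real lineage; not a discharge of N15; NE2⁺ NOT PRINTED ∕ not proved; one finite 𝕋⁴
programme at fixed ε — nothing continuum ∕ ℝ⁴ ∕ OS ∕ mass-gap ∕ Clay.
Locators: [Balaban1985BackgroundPropagators] Thm 3.1 (3.42)–(3.43) pp. 397–398, (3.35)–(3.37) p. 396, (3.52)–(3.53) p. 400, (3.63)–(3.65) pp. 402–403 (shapes,
mechanism); [King1986] (2.13)–(2.17) p. 653, (2.20) p. 654, Thm 3.3 p. 655, (3.7)–(3.8) p. 656, p. 664 (pairing), Prop. 3.9 (3.73) p. 665; [Balaban1983RegularityDecay]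
(1.9)–(1.10) p. 573; [Balaban1984PropagatorsII] (2.51) p. 232, (2.156) p. 250.
-/

noncomputable section

namespace Summit.QuantumFields.YangMills.BalabanUVNodes.N15KingModelRung.Curved

open Real Finset Matrix NormedSpace
open Literature.MathematicalPhysics.QuantumFieldTheory.Balaban1983to89
open Literature.MathematicalPhysics.QuantumFieldTheory.Balaban1983to89.B11SectG (BlockNorm HasMaj RowSum)
open Literature.MathematicalPhysics.QuantumFieldTheory.Balaban1983to89.B6RandomWalk (Triangle254)
open Literature.MathematicalPhysics.QuantumFieldTheory.Balaban1983to89.B6UnitTorusCarrier (unitTorusGeo triangle254_unitTorusGeo rowSum_unitTorusGeo)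
open Literature.MathematicalPhysics.QuantumFieldTheory.Balaban1983to89.T4EtaRateDefect (idef idef_apply idef_comp)
open Literature.MathematicalPhysics.QuantumFieldTheory.Balaban1983to89.T4EtaRateCoeffDefect (pull pull_apply)
open Literature.MathematicalPhysics.QuantumFieldTheory.Balaban1983to89.B5Prop11Plancherel (Tor fine unitVec)
open Literature.MathematicalPhysics.QuantumFieldTheory.King1986 (aK)
open Literature.MathematicalPhysics.QuantumFieldTheory.King1986.Torus (fineOp blockOf tdistT tdistT_nonneg)
open Summit.QuantumFields.YangMills.BalabanUVNodes.N15.VectorPiece (unitTorusGeoS tensorId tensorId_apply hasMaj_tensorId idef_tensorId)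
open Summit.QuantumFields.YangMills.BalabanUVNodes.N15.MatrixSpecies (liftMap liftBlk liftEquiv liftEquiv_apply liftEquiv_symm_apply coordMat coordMat_sub basisConst
  basisConst_nonneg Phi0)
open Summit.QuantumFields.YangMills.BalabanUVNodes.N15.BackgroundLayer (fgrad bgrad liftPair blkPair coordMat_smul coordMat_one)
open Summit.QuantumFields.YangMills.BalabanUVNodes.N15.CurvedSpecies (torStep blockMeanField blockMeanTV covPieces covPieces_one gaugePair gaugePair_one
  curvDressed expTrField expTrField_apply expRowLetter expFitLetter curvFitLetter gradFitLetter expRowLetter_nonneg torStep_symm_apply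
  hasMaj_idef_curvDressed_kingTorus)

variable {d : ℕ} (L : ℕ)

/-! ## The King inhabitant of the curved knit -/

section Knit

variable [NeZero L]

/-- ★★ **THE KING INHABITANT OF dag-n15-w3's CURVED KNIT.**  For odd `L ≥ 3`, `a > 0`, `m₀² ≥ 0`, `0 < γ < 1`, `0 < α < 1` there are `β, δ, m > 0` such that for every
`K ≥ 1`, cube `M₀ ≡ 2L^e`, mass `0 < m² ≤ m₀²`, size datum `Msz`, every coordinate system `e : 𝔄 ≃ ℝ^ι` of a complete normed algebra and every CONSTANT generator datum
`Zc : Fin (d+1) → (𝔄 →L 𝔄)` with `‖Zc μ‖ ≤ r ≤ 1` and skew coordinates, under dag-n15-w3's Neumann smallness at the generator-level row letter (`σ = ρ = δ∕2`,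
`c_r = latticeConst (d+1) (δ∕2)`): `CurvedSpecies.hasMaj_idef_curvDressed_kingTorus`'s CONCLUSION holds VERBATIM for the objects coarse torus `Tor (fine (L^K) M₀)`
(`η = L·η′ = L^{−K}`), fine torus `Tor (fine L (fine (L^K) M₀))` (`η′ = L^{−(K+1)}`), `blk = blockOf (L^K) M₀` into `unitTorusGeoS L K M₀ Msz`, `W′ = 0`, `Z′_μ ≡ Zc μ`,
`G = A₀⁻¹ ⊗ 1_ι`, `G′ = (cast∘A₀′⁻¹∘cast⁻¹) ⊗ 1_ι`, inductive-datum sizes `β`, defects `m·((L^K)^{−γ∕2} + (L^K)^{−α})`, letters `r_B = g = g_B = G₂ = 0`, `η₀ = 1` — every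
inductive-datum hypothesis and every carrier ∕ regime ∕ fine-field letter a theorem of the rung. [cite: Balaban1985BackgroundPropagators, (3.35)–(3.37) p.396, Thm 3.1 (3.42)–(3.43) pp.397–398, (3.52)–(3.53) p.400, (3.63)–(3.65) pp.402–403 (shapes, mechanism); King1986, (2.13)–(2.17) p.653, Thm 3.3 p.655, (3.7)–(3.8) p.656, p.664, Prop. 3.9 (3.73) p.665; Balaban1983RegularityDecay, (1.9)–(1.10) p.573] -/
theorem hasMaj_idef_curvDressed_kingTorus_king (hLodd : Odd L) (hL : 2 ≤ L) {a : ℝ} (ha : 0 < a) {m0sq : ℝ} (hm0 : 0 ≤ m0sq) {γ : ℝ} (hγ0 : 0 < γ)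
    (hγ1 : γ < 1) {α : ℝ} (hα0 : 0 < α) (hα1 : α < 1) :
    ∃ β δ m : ℝ, 0 < β ∧ 0 < δ ∧ 0 < m ∧ ∀ (K : ℕ), 1 ≤ K → ∀ (e : ℕ) (M : Fin (d + 1) → ℕ) [∀ μ, NeZero (M μ)], (∀ μ, M μ = 2 * L ^ e) →
      ∀ (msq : ℝ), 0 < msq → msq ≤ m0sq → ∀ (Msz : ℝ)
      (ι : Type) [Fintype ι] [DecidableEq ι] (𝔄 : Type) [NormedRing 𝔄] [NormedAlgebra ℝ 𝔄] [CompleteSpace 𝔄] (eB : 𝔄 ≃L[ℝ] (ι → ℝ))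
      (Zc : Fin (d + 1) → (𝔄 →L[ℝ] 𝔄)) (r : ℝ), 0 ≤ r → r ≤ 1 → (∀ μ, ‖Zc μ‖ ≤ r) → (∀ μ, (coordMat eB (Zc μ))ᵀ = -coordMat eB (Zc μ)) →
      β * (expRowLetter ι (Fin (d + 1)) (basisConst eB) r 0 0 * (1 + Fintype.card (Fin (d + 1) ⊕ Fin (d + 1)))) * B4Sect5Proof.latticeConst (d + 1) (δ / 2) < 1 →
    HasMaj (BlockNorm.ofBlocks (unitTorusGeoS L K M Msz) (liftBlk (blockOf (L ^ K) M) ι)) (BlockNorm.ofBlocks (unitTorusGeoS L K M Msz) (blkPair (liftBlk (blockOf (L ^ K) M ∘ blockOf L (fine (L ^ K) M)) ι)))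
      (idef (pull (liftMap (blockOf L (fine (L ^ K) M)) ι)) (pull (liftPair (liftMap (blockOf L (fine (L ^ K) M)) ι)))
        (curvDressed ((L : ℝ) ^ (K + 1))⁻¹ (torStep (fine L (fine (L ^ K) M))) (expTrField eB ((L : ℝ) ^ (K + 1))⁻¹ 0) (expTrField eB ((L : ℝ) ^ (K + 1))⁻¹ (fun μ _ => Zc μ)) (kingGT₁ L a msq K M ι))
        (curvDressed ((L : ℝ) * ((L : ℝ) ^ (K + 1))⁻¹) (torStep (fine (L ^ K) M)) (expTrField eB ((L : ℝ) * ((L : ℝ) ^ (K + 1))⁻¹) (blockMeanField L (fine (L ^ K) M) 0)) (expTrField eB ((L : ℝ) * ((L : ℝ) ^ (K + 1))⁻¹) (blockMeanField L (fine (L ^ K) M) (fun μ _ => Zc μ))) (kingGT L a msq K M ι)))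
      (fun y y' => (m * (((L : ℝ) ^ K) ^ (-(γ / 2)) + ((L : ℝ) ^ K) ^ (-α)) * B4Sect5Proof.latticeConst (d + 1) (δ / 2) + 1 * (m * (((L : ℝ) ^ K) ^ (-(γ / 2)) + ((L : ℝ) ^ K) ^ (-α)) * B4Sect5Proof.latticeConst (d + 1) (δ / 2)) * (expRowLetter ι (Fin (d + 1)) (basisConst eB) r 0 0 * (1 + Fintype.card (Fin (d + 1) ⊕ Fin (d + 1))) *
          (β * (1 - β * (expRowLetter ι (Fin (d + 1)) (basisConst eB) r 0 0 * (1 + Fintype.card (Fin (d + 1) ⊕ Fin (d + 1)))) * B4Sect5Proof.latticeConst (d + 1) (δ / 2))⁻¹)) +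
          β * (expFitLetter ι (Fin (d + 1)) (basisConst eB) r 0 0 (((d + 1 : ℕ) : ℝ) * ((L : ℝ) * ((L : ℝ) ^ (K + 1))⁻¹) * 0) (((d + 1 : ℕ) : ℝ) * ((L : ℝ) * ((L : ℝ) ^ (K + 1))⁻¹) * 0 + (L : ℝ) * ((L : ℝ) ^ (K + 1))⁻¹ * 0)
              (((d + 1 : ℕ) : ℝ) * ((L : ℝ) * ((L : ℝ) ^ (K + 1))⁻¹) * 0 + (L : ℝ) * ((L : ℝ) ^ (K + 1))⁻¹ * 0) ((((d + 1 : ℕ) : ℝ) + 1) * ((L : ℝ) * ((L : ℝ) ^ (K + 1))⁻¹) * 0) ((L : ℝ) * ((L : ℝ) ^ (K + 1))⁻¹) * (1 + Fintype.card (Fin (d + 1) ⊕ Fin (d + 1)))) *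
            (β * (1 - β * (expRowLetter ι (Fin (d + 1)) (basisConst eB) r 0 0 * (1 + Fintype.card (Fin (d + 1) ⊕ Fin (d + 1)))) * B4Sect5Proof.latticeConst (d + 1) (δ / 2))⁻¹) * B4Sect5Proof.latticeConst (d + 1) (δ / 2)) *
        (1 - 1 * (β * (expRowLetter ι (Fin (d + 1)) (basisConst eB) r 0 0 * (1 + Fintype.card (Fin (d + 1) ⊕ Fin (d + 1)))) * B4Sect5Proof.latticeConst (d + 1) (δ / 2)))⁻¹ * Real.exp (-(δ / 2 * tdistT M y y'))) := by
  obtain ⟨β, δ, m, hβ, hδ, hm, H⟩ := kingFullProp_uniform_layer_backward (d := d) L hLodd hL ha hm0 hγ0.le hγ1 hα0 hα1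
  refine ⟨β, δ, m, hβ, hδ, hm, fun K hK e M _ hM msq hmsq hcap Msz ι _ _ 𝔄 _ _ _ eB Zc r hr0 hr1 hZc hZcs hq => ?_⟩
  have hL1 : (1 : ℝ) ≤ (L : ℝ) := by exact_mod_cast (show 1 ≤ L by omega)
  have hL0 : (0 : ℝ) < (L : ℝ) := by positivity
  have hη' : 0 < ((L : ℝ) ^ (K + 1))⁻¹ := by positivity
  have hθ0 : 0 ≤ ((L : ℝ) ^ K) ^ (-(γ / 2)) + ((L : ℝ) ^ K) ^ (-α) :=
    add_nonneg (Real.rpow_nonneg (pow_nonneg hL0.le _) _) (Real.rpow_nonneg (pow_nonneg hL0.le _) _)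
  have hmθ : 0 ≤ m * (((L : ℝ) ^ K) ^ (-(γ / 2)) + ((L : ℝ) ^ K) ^ (-α)) := mul_nonneg hm.le hθ0
  have hηη₀ : (L : ℝ) * ((L : ℝ) ^ (K + 1))⁻¹ ≤ 1 := by
    rw [pow_succ', mul_inv, ← mul_assoc, mul_inv_cancel₀ hL0.ne', one_mul]
    exact inv_le_one_of_one_le₀ (one_le_pow₀ hL1)
  -- the carrier facts
  have hσ : 0 < δ / 2 := half_pos hδ
  have htri : Triangle254 (unitTorusGeoS L K M Msz) := triangle254_unitTorusGeo L K M
  have hd : ∀ a b : (unitTorusGeoS L K M Msz).Site, 0 ≤ (unitTorusGeoS L K M Msz).dist a b := fun a b => tdistT_nonneg M a b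
  have hrow : RowSum (unitTorusGeoS L K M Msz) (δ / 2) (B4Sect5Proof.latticeConst (d + 1) (δ / 2)) := rowSum_unitTorusGeo L K M hσ
  have hcr : 0 ≤ B4Sect5Proof.latticeConst (d + 1) (δ / 2) := B4Sect5Proof.latticeConst_nonneg (d + 1) hσ.le
  -- the nine scalar letters one level up (`n = 1`), their majorants nonnegative
  have HK := fun μ : Fin (d + 1) => H K hK 1 le_rfl e M hM msq hmsq hcap Msz μ
  have maj0 : ∀ y y' : Tor M, 0 ≤ β * Real.exp (-(δ * tdistT M y y')) := fun _ _ => by positivity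
  have majm : ∀ y y' : Tor M, 0 ≤ m * (((L : ℝ) ^ K) ^ (-(γ / 2)) + ((L : ℝ) ^ K) ^ (-α)) * Real.exp (-(δ * tdistT M y y')) :=
    fun _ _ => mul_nonneg hmθ (Real.exp_nonneg _)
  -- (hG) `G = A₀⁻¹ ⊗ 1`
  have hG : HasMaj (BlockNorm.ofBlocks (unitTorusGeoS L K M Msz) (liftBlk (blockOf (L ^ K) M) ι))
      (BlockNorm.ofBlocks (unitTorusGeoS L K M Msz) (liftBlk (blockOf (L ^ K) M) ι)) (kingGT L a msq K M ι)
      (fun y y' => β * Real.exp (-(δ * (unitTorusGeoS L K M Msz).dist y y'))) :=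
    hasMaj_tensorId ι maj0 (HK 0).1
  -- (hD) the coarse covariant pieces at the flat point
  have hD : ∀ j, HasMaj (BlockNorm.ofBlocks (unitTorusGeoS L K M Msz) (liftBlk (blockOf (L ^ K) M) ι))
      (BlockNorm.ofBlocks (unitTorusGeoS L K M Msz) (liftBlk (blockOf (L ^ K) M) ι))
      (covPieces ((L : ℝ) * ((L : ℝ) ^ (K + 1))⁻¹) (torStep (fine (L ^ K) M))
        (gaugePair (torStep (fine (L ^ K) M)) (expTrField eB ((L : ℝ) * ((L : ℝ) ^ (K + 1))⁻¹)
          (blockMeanField L (fine (L ^ K) M) (0 : Fin (d + 1) → Tor (fine L (fine (L ^ K) M)) → (𝔄 →L[ℝ] 𝔄))))) (kingGT L a msq K M ι) j)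
      (fun y y' => β * Real.exp (-(δ * (unitTorusGeoS L K M Msz).dist y y'))) := by
    intro j
    rw [blockMeanField_zero, expTrField_zero, gaugePair_one]
    cases j with
    | inl μ => rw [covPieces_flat_coarse_inl]; exact hasMaj_tensorId ι maj0 (HK μ).2.1
    | inr μ => rw [covPieces_flat_coarse_inr]; exact hasMaj_tensorId ι maj0 (HK μ).2.2.1
  -- (hG′) `G′ = (cast∘A₀′⁻¹∘cast⁻¹) ⊗ 1`
  have hG' : HasMaj (BlockNorm.ofBlocks (unitTorusGeoS L K M Msz) (liftBlk (blockOf (L ^ K) M ∘ blockOf L (fine (L ^ K) M)) ι))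
      (BlockNorm.ofBlocks (unitTorusGeoS L K M Msz) (liftBlk (blockOf (L ^ K) M ∘ blockOf L (fine (L ^ K) M)) ι)) (kingGT₁ L a msq K M ι)
      (fun y y' => β * Real.exp (-(δ * (unitTorusGeoS L K M Msz).dist y y'))) := by
    refine hasMaj_tensorId ι maj0 ?_
    rw [blockOf_comp_blockOf_eq]
    exact hasMaj_conjEquiv _ _ (castT L K M) maj0 (HK 0).2.2.2.1
  -- (hD′) the fine covariant pieces at the flat point
  have hD' : ∀ j, HasMaj (BlockNorm.ofBlocks (unitTorusGeoS L K M Msz) (liftBlk (blockOf (L ^ K) M ∘ blockOf L (fine (L ^ K) M)) ι))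
      (BlockNorm.ofBlocks (unitTorusGeoS L K M Msz) (liftBlk (blockOf (L ^ K) M ∘ blockOf L (fine (L ^ K) M)) ι))
      (covPieces (((L : ℝ) ^ (K + 1))⁻¹) (torStep (fine L (fine (L ^ K) M)))
        (gaugePair (torStep (fine L (fine (L ^ K) M))) (expTrField eB (((L : ℝ) ^ (K + 1))⁻¹)
          (0 : Fin (d + 1) → Tor (fine L (fine (L ^ K) M)) → (𝔄 →L[ℝ] 𝔄)))) (kingGT₁ L a msq K M ι) j)
      (fun y y' => β * Real.exp (-(δ * (unitTorusGeoS L K M Msz).dist y y'))) := by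
    intro j
    rw [expTrField_zero, gaugePair_one]
    cases j with
    | inl μ =>
        rw [covPieces_flat_fine_inl]
        refine hasMaj_tensorId ι maj0 ?_
        rw [blockOf_comp_blockOf_eq]
        exact hasMaj_conjEquiv _ _ (castT L K M) maj0 (HK μ).2.2.2.2.1
    | inr μ =>
        rw [covPieces_flat_fine_inr]
        refine hasMaj_tensorId ι maj0 ?_
        rw [blockOf_comp_blockOf_eq]
        exact hasMaj_conjEquiv _ _ (castT L K M) maj0 (HK μ).2.2.2.2.2.1
  -- (hDG) the two-grid defect of `G`
  have hDG : HasMaj (BlockNorm.ofBlocks (unitTorusGeoS L K M Msz) (liftBlk (blockOf (L ^ K) M) ι))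
      (BlockNorm.ofBlocks (unitTorusGeoS L K M Msz) (liftBlk (blockOf (L ^ K) M ∘ blockOf L (fine (L ^ K) M)) ι))
      (idef (pull (liftMap (blockOf L (fine (L ^ K) M)) ι)) (pull (liftMap (blockOf L (fine (L ^ K) M)) ι)) (kingGT₁ L a msq K M ι) (kingGT L a msq K M ι))
      (fun y y' => m * (((L : ℝ) ^ K) ^ (-(γ / 2)) + ((L : ℝ) ^ K) ^ (-α)) * Real.exp (-(δ * (unitTorusGeoS L K M Msz).dist y y'))) := by
    rw [kingGT₁, kingGT, idef_tensorId]
    refine hasMaj_tensorId ι majm ?_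
    rw [kingGOp₁, idef_conj_eq, blockOf_comp_blockOf_eq]
    exact hasMaj_pullEquiv_comp _ (castT L K M) majm (HK 0).2.2.2.2.2.2.1
  -- (hDD) the two-grid defects of the covariant pieces
  have hDD : ∀ j, HasMaj (BlockNorm.ofBlocks (unitTorusGeoS L K M Msz) (liftBlk (blockOf (L ^ K) M) ι))
      (BlockNorm.ofBlocks (unitTorusGeoS L K M Msz) (liftBlk (blockOf (L ^ K) M ∘ blockOf L (fine (L ^ K) M)) ι))
      (idef (pull (liftMap (blockOf L (fine (L ^ K) M)) ι)) (pull (liftMap (blockOf L (fine (L ^ K) M)) ι))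
        (covPieces (((L : ℝ) ^ (K + 1))⁻¹) (torStep (fine L (fine (L ^ K) M)))
          (gaugePair (torStep (fine L (fine (L ^ K) M))) (expTrField eB (((L : ℝ) ^ (K + 1))⁻¹)
            (0 : Fin (d + 1) → Tor (fine L (fine (L ^ K) M)) → (𝔄 →L[ℝ] 𝔄)))) (kingGT₁ L a msq K M ι) j)
        (covPieces ((L : ℝ) * ((L : ℝ) ^ (K + 1))⁻¹) (torStep (fine (L ^ K) M))
          (gaugePair (torStep (fine (L ^ K) M)) (expTrField eB ((L : ℝ) * ((L : ℝ) ^ (K + 1))⁻¹)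
            (blockMeanField L (fine (L ^ K) M) (0 : Fin (d + 1) → Tor (fine L (fine (L ^ K) M)) → (𝔄 →L[ℝ] 𝔄))))) (kingGT L a msq K M ι) j))
      (fun y y' => m * (((L : ℝ) ^ K) ^ (-(γ / 2)) + ((L : ℝ) ^ K) ^ (-α)) * Real.exp (-(δ * (unitTorusGeoS L K M Msz).dist y y'))) := by
    intro j
    rw [blockMeanField_zero, expTrField_zero, expTrField_zero, gaugePair_one, gaugePair_one]
    cases j with
    | inl μ =>
        rw [covPieces_flat_fine_inl, covPieces_flat_coarse_inl, idef_tensorId]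
        refine hasMaj_tensorId ι majm ?_
        rw [idef_conj_eq, blockOf_comp_blockOf_eq]
        exact hasMaj_pullEquiv_comp _ (castT L K M) majm (HK μ).2.2.2.2.2.2.2.1
    | inr μ =>
        rw [covPieces_flat_fine_inr, covPieces_flat_coarse_inr, idef_tensorId]
        refine hasMaj_tensorId ι majm ?_
        rw [idef_conj_eq, blockOf_comp_blockOf_eq]
        exact hasMaj_pullEquiv_comp _ (castT L K M) majm (HK μ).2.2.2.2.2.2.2.2
  -- the knit
  exact hasMaj_idef_curvDressed_kingTorus L (fine (L ^ K) M) eB (blockOf (L ^ K) M) (((L : ℝ) ^ (K + 1))⁻¹) (fun μ _ => Zc μ) 0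
    (kingGT L a msq K M ι) (kingGT₁ L a msq K M ι) (geo := unitTorusGeoS L K M Msz) (σ := δ / 2) (cr := B4Sect5Proof.latticeConst (d + 1) (δ / 2))
    (ρ := δ / 2) (δ := δ) (β := β) (m := m * (((L : ℝ) ^ K) ^ (-(γ / 2)) + ((L : ℝ) ^ K) ^ (-α))) (η₀ := 1) (r := r) (rB := 0) (g := 0) (gB := 0) (G₂ := 0)
    htri hd hσ.le hcr hrow hσ.le (by linarith) hβ.le hmθ (by rw [one_mul]; exact hr1) (by norm_num) hη' hηη₀ hr0 le_rfl le_rfl le_rfl le_rfl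
    hG hD hG' hD' hDG hDD (fun μ _ => hZc μ) (fun _ _ => by simp) (fun _ _ _ => by simp) (fun _ _ _ => by simp) (fun _ _ _ => by simp)
    (fun μ _ => hZcs μ) (fun _ _ => by
      have h0 := coordMat_sub eB (0 : 𝔄 →L[ℝ] 𝔄) 0
      rw [sub_self, sub_self] at h0
      rw [Pi.zero_apply, Pi.zero_apply, h0, Matrix.transpose_zero, neg_zero]) hq


/-- AT THE FLAT POINT THE FIT LETTER IS QUADRATIC IN THE GENERATOR SIZE AND LINEAR IN THE SPACING: with `r_B = g = 0` and the derived fits `o = o_t = o_W = o_D = 0` (as the knit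
spells them), `expFitLetter κ r 0 0 … η = 2κe·r²η·(|ι| + |ι|³ + 2|ι|²|J|·κer)`. [folklore] -/
theorem expFitLetter_flat (ι J : Type) [Fintype ι] [Fintype J] (κ r a b c η : ℝ) :
    expFitLetter ι J κ r 0 0 (a * 0) (a * 0 + b * 0) (a * 0 + b * 0) (c * 0) η =
      2 * κ * Real.exp 1 * r ^ 2 * η * ((Fintype.card ι : ℝ) + (Fintype.card ι : ℝ) ^ 3 + 2 * (Fintype.card ι : ℝ) ^ 2 * (Fintype.card J : ℝ) * (κ * Real.exp 1 * r)) := by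
  unfold expFitLetter curvFitLetter gradFitLetter
  ring

/-- THE NEUMANN CONSTANT UNDER THE HALVED SMALLNESS (pure arithmetic): with `A, c_r, R, β, F ≥ 0` and `βRc_r ≤ ½`,
`(Ac_r + Ac_r·R·β(1 − βRc_r)⁻¹ + β·F·β(1 − βRc_r)⁻¹·c_r)·(1 − βRc_r)⁻¹ ≤ 2c_r(A(1 + 2βR) + 2β²F)` (the knit's constant, its bracketing kept). [folklore] -/
theorem knitConst_le {A cr R β F : ℝ} (hA : 0 ≤ A) (hcr : 0 ≤ cr) (hR : 0 ≤ R) (hβ : 0 ≤ β) (hF : 0 ≤ F) (hq : β * R * cr ≤ 1 / 2) :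
    (A * cr + 1 * (A * cr) * (R * (β * (1 - β * R * cr)⁻¹)) + β * F * (β * (1 - β * R * cr)⁻¹) * cr) * (1 - 1 * (β * R * cr))⁻¹ ≤
      2 * cr * (A * (1 + 2 * β * R) + 2 * β ^ 2 * F) := by
  have hq0 : 0 ≤ β * R * cr := by positivity
  have hDpos : 0 < 1 - β * R * cr := by linarith
  have hDinv : (1 - β * R * cr)⁻¹ ≤ 2 := by rw [inv_le_comm₀ hDpos (by norm_num)]; linarith
  have hDinv0 : 0 ≤ (1 - β * R * cr)⁻¹ := inv_nonneg.mpr hDpos.le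
  rw [one_mul, one_mul]
  have h1 : A * cr * (R * (β * (1 - β * R * cr)⁻¹)) ≤ A * cr * (R * (β * 2)) := by gcongr
  have h2 : β * F * (β * (1 - β * R * cr)⁻¹) * cr ≤ β * F * (β * 2) * cr := by gcongr
  have hS0 : 0 ≤ A * cr + A * cr * (R * (β * 2)) + β * F * (β * 2) * cr := by positivity
  calc (A * cr + A * cr * (R * (β * (1 - β * R * cr)⁻¹)) + β * F * (β * (1 - β * R * cr)⁻¹) * cr) * (1 - β * R * cr)⁻¹
      ≤ (A * cr + A * cr * (R * (β * 2)) + β * F * (β * 2) * cr) * 2 := mul_le_mul (by linarith) hDinv hDinv0 hS0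
    _ = 2 * cr * (A * (1 + 2 * β * R) + 2 * β ^ 2 * F) := by ring

/-- ★ **THE η-RATE OF THE DRESSED PAIR, EXPLICIT.**  Under the (harmless) halved Neumann smallness `β·R_V·c_r ≤ ½` the majorant of `hasMaj_idef_curvDressed_kingTorus_king` is at most
`2c_r·(m·θ_K·(1 + 2βR_V) + 2β²·F)·e^{−(δ∕2)|y−y′|_T}`, `θ_K = (L^K)^{−γ∕2} + (L^K)^{−α}`, with the flat-point fit letter
`F = 2κ_e e·r²·L^{−K}·(|ι| + |ι|³ + 2|ι|²(d+1)·κ_e e r)·(1 + |J ⊕ J|)` (`expFitLetter_flat`): the two-grid defect of King's dressed pair is an η-RATE — the rung's `θ_K` from the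
inductive datum plus `r²·L^{−K}` from the transporter fit. [cite: Balaban1985BackgroundPropagators, Thm 3.1 (3.42) p.397 (η-rate shape), (3.63)–(3.65) pp.402–403 (mechanism); King1986, Prop. 3.9 (3.73) p.665 (shape)] -/
theorem hasMaj_idef_curvDressed_kingTorus_king_rate (hLodd : Odd L) (hL : 2 ≤ L) {a : ℝ} (ha : 0 < a) {m0sq : ℝ} (hm0 : 0 ≤ m0sq) {γ : ℝ} (hγ0 : 0 < γ)
    (hγ1 : γ < 1) {α : ℝ} (hα0 : 0 < α) (hα1 : α < 1) :
    ∃ β δ m : ℝ, 0 < β ∧ 0 < δ ∧ 0 < m ∧ ∀ (K : ℕ), 1 ≤ K → ∀ (e : ℕ) (M : Fin (d + 1) → ℕ) [∀ μ, NeZero (M μ)], (∀ μ, M μ = 2 * L ^ e) →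
      ∀ (msq : ℝ), 0 < msq → msq ≤ m0sq → ∀ (Msz : ℝ)
      (ι : Type) [Fintype ι] [DecidableEq ι] (𝔄 : Type) [NormedRing 𝔄] [NormedAlgebra ℝ 𝔄] [CompleteSpace 𝔄] (eB : 𝔄 ≃L[ℝ] (ι → ℝ))
      (Zc : Fin (d + 1) → (𝔄 →L[ℝ] 𝔄)) (r : ℝ), 0 ≤ r → r ≤ 1 → (∀ μ, ‖Zc μ‖ ≤ r) → (∀ μ, (coordMat eB (Zc μ))ᵀ = -coordMat eB (Zc μ)) →
      β * (expRowLetter ι (Fin (d + 1)) (basisConst eB) r 0 0 * (1 + Fintype.card (Fin (d + 1) ⊕ Fin (d + 1)))) * B4Sect5Proof.latticeConst (d + 1) (δ / 2) ≤ 1 / 2 →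
      HasMaj (BlockNorm.ofBlocks (unitTorusGeoS L K M Msz) (liftBlk (blockOf (L ^ K) M) ι))
        (BlockNorm.ofBlocks (unitTorusGeoS L K M Msz) (blkPair (liftBlk (blockOf (L ^ K) M ∘ blockOf L (fine (L ^ K) M)) ι)))
        (idef (pull (liftMap (blockOf L (fine (L ^ K) M)) ι)) (pull (liftPair (liftMap (blockOf L (fine (L ^ K) M)) ι)))
          (curvDressed ((L : ℝ) ^ (K + 1))⁻¹ (torStep (fine L (fine (L ^ K) M))) (expTrField eB ((L : ℝ) ^ (K + 1))⁻¹ 0)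
            (expTrField eB ((L : ℝ) ^ (K + 1))⁻¹ (fun μ _ => Zc μ)) (kingGT₁ L a msq K M ι))
          (curvDressed ((L : ℝ) * ((L : ℝ) ^ (K + 1))⁻¹) (torStep (fine (L ^ K) M))
            (expTrField eB ((L : ℝ) * ((L : ℝ) ^ (K + 1))⁻¹) (blockMeanField L (fine (L ^ K) M) 0))
            (expTrField eB ((L : ℝ) * ((L : ℝ) ^ (K + 1))⁻¹) (blockMeanField L (fine (L ^ K) M) (fun μ _ => Zc μ))) (kingGT L a msq K M ι)))
        (fun y y' => 2 * B4Sect5Proof.latticeConst (d + 1) (δ / 2) *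
            (m * (((L : ℝ) ^ K) ^ (-(γ / 2)) + ((L : ℝ) ^ K) ^ (-α)) *
                (1 + 2 * β * (expRowLetter ι (Fin (d + 1)) (basisConst eB) r 0 0 * (1 + Fintype.card (Fin (d + 1) ⊕ Fin (d + 1))))) +
              2 * β ^ 2 * (2 * basisConst eB * Real.exp 1 * r ^ 2 * ((L : ℝ) * ((L : ℝ) ^ (K + 1))⁻¹) *
                ((Fintype.card ι : ℝ) + (Fintype.card ι : ℝ) ^ 3 + 2 * (Fintype.card ι : ℝ) ^ 2 * (Fintype.card (Fin (d + 1)) : ℝ) * (basisConst eB * Real.exp 1 * r)) *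
                (1 + Fintype.card (Fin (d + 1) ⊕ Fin (d + 1))))) *
          Real.exp (-(δ / 2 * tdistT M y y'))) := by
  obtain ⟨β, δ, m, hβ, hδ, hm, H⟩ := hasMaj_idef_curvDressed_kingTorus_king (d := d) L hLodd hL ha hm0 hγ0 hγ1 hα0 hα1
  refine ⟨β, δ, m, hβ, hδ, hm, fun K hK e M _ hM msq hmsq hcap Msz ι _ _ 𝔄 _ _ _ eB Zc r hr0 hr1 hZc hZcs hq2 => ?_⟩
  have hL0 : (0 : ℝ) < (L : ℝ) := by exact_mod_cast (show 0 < L by omega)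
  have hcr : 0 ≤ B4Sect5Proof.latticeConst (d + 1) (δ / 2) := B4Sect5Proof.latticeConst_nonneg (d + 1) (half_pos hδ).le
  have hκ : 0 ≤ basisConst eB := basisConst_nonneg eB
  have hcard : (0 : ℝ) ≤ 1 + Fintype.card (Fin (d + 1) ⊕ Fin (d + 1)) := by positivity
  have hR : 0 ≤ expRowLetter ι (Fin (d + 1)) (basisConst eB) r 0 0 * (1 + Fintype.card (Fin (d + 1) ⊕ Fin (d + 1))) :=
    mul_nonneg (expRowLetter_nonneg (ι := ι) (J := Fin (d + 1)) hκ hr0 le_rfl le_rfl) hcard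
  have hθ : 0 ≤ m * (((L : ℝ) ^ K) ^ (-(γ / 2)) + ((L : ℝ) ^ K) ^ (-α)) :=
    mul_nonneg hm.le (add_nonneg (Real.rpow_nonneg (pow_nonneg hL0.le _) _) (Real.rpow_nonneg (pow_nonneg hL0.le _) _))
  have hη₁ : 0 ≤ (L : ℝ) * ((L : ℝ) ^ (K + 1))⁻¹ := by positivity
  have hF : 0 ≤ expFitLetter ι (Fin (d + 1)) (basisConst eB) r 0 0 (((d + 1 : ℕ) : ℝ) * ((L : ℝ) * ((L : ℝ) ^ (K + 1))⁻¹) * 0)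
      (((d + 1 : ℕ) : ℝ) * ((L : ℝ) * ((L : ℝ) ^ (K + 1))⁻¹) * 0 + (L : ℝ) * ((L : ℝ) ^ (K + 1))⁻¹ * 0)
      (((d + 1 : ℕ) : ℝ) * ((L : ℝ) * ((L : ℝ) ^ (K + 1))⁻¹) * 0 + (L : ℝ) * ((L : ℝ) ^ (K + 1))⁻¹ * 0)
      ((((d + 1 : ℕ) : ℝ) + 1) * ((L : ℝ) * ((L : ℝ) ^ (K + 1))⁻¹) * 0) ((L : ℝ) * ((L : ℝ) ^ (K + 1))⁻¹) *
      (1 + Fintype.card (Fin (d + 1) ⊕ Fin (d + 1))) := by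
    rw [expFitLetter_flat]; positivity
  have hq1 : β * (expRowLetter ι (Fin (d + 1)) (basisConst eB) r 0 0 * (1 + Fintype.card (Fin (d + 1) ⊕ Fin (d + 1)))) *
      B4Sect5Proof.latticeConst (d + 1) (δ / 2) < 1 := by linarith
  refine (H K hK e M hM msq hmsq hcap Msz ι 𝔄 eB Zc r hr0 hr1 hZc hZcs hq1).mono fun y y' => mul_le_mul_of_nonneg_right ?_ (Real.exp_nonneg _)
  refine (knitConst_le hθ hcr hR hβ.le hF hq2).trans (le_of_eq ?_)
  rw [expFitLetter_flat]

end Knit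

end Summit.QuantumFields.YangMills.BalabanUVNodes.N15KingModelRung.Curved

end
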